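import Mathlib
import Summits.Ventures.PercRepro2.Defs
import Summits.Ventures.PercRepro2.Graph
import Summits.Ventures.PercRepro2.Induced
import Summits.Ventures.PercRepro2.VdBKahn
import Summits.Ventures.PercRepro2.ReimerVdBK
import Summits.Ventures.PercRepro2.ReimerVdBKRegions

/-!
# The leaf-gadget transfer for type weights of (R-1.2)
(blind cell PercRepro2, mine-c g45; `conjectures/MINE-C.md` §54.2)

Every vertex `v` of a 2-colouring `ω` has a TYPE: `0` = core (`v ∈ K₁ ∩ K₂`), `1` = world-1-private
(`K₁ ∖ K₂`), `2` = world-2-private (`K₂ ∖ K₁`), `3` = neither.  A weight `w : Fin 4 → ℚ` on the type of an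
unmarked vertex turns the two-world count into `∑_{ω ∈ twoWorld} w (type v ω)`; (R-1.2) is the weight
`(1,1,1,1)`, the conditioning `v ∈ Z` is `(0,0,0,1)`, g44's core-down-set form is `(0,1,1,1)`.

THE TRANSFER.  Let `ℓ` be a LEAF: its only edge is `f = {ℓ, u}`.  Then `ℓ` is never in the core,
`ℓ ∈ K₁ ↔ (f red ∧ u ∈ K₁)`, `ℓ ∈ K₂ ↔ (f blue ∧ u ∈ K₂)`, and the membership of every other vertex in
either world does not depend on the colour of `f`.  Summing over the two colours of `f`, a weight `w` on the
type of `ℓ` becomes the weight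

  `T w = (w 1 + w 2, w 1 + w 3, w 2 + w 3, 2 · w 3)`

on the type of `u`: `2 · ∑_{ω ∈ 𝒜} w (type ℓ ω) = ∑_{ω ∈ 𝒜} (T w) (type u ω)` for every event `𝒜` that does
not look at `f` — in particular for the two-world events of an instance in which `ℓ` is unmarked
(`leafGadget_twoWorld`).  Consequences recorded in `MINE-C.md` §54.2–54.3: `k` leaves at `u` all
constrained to one world (or to the union) are the weight `(2^k, 1, 1, 0)` at `u`, which explains g44's
negative on the hub graph (two leaves at a vertex of the 4-cycle = the weight `(4,1,1,0)`, while the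
4-cycle carries at most `(3,1,1,0)`), and turns the n = 7 ratio `11/6 < 2` into the n = 8 failure of the
single-vertex statements «`v` in the union» / «`v` in exactly one world».
-/

namespace Summit.Ventures.PercRepro2

namespace ReimerVdBK

open Classical

variable {V : Type*} {E : Type*} [Fintype E] [DecidableEq E] [Fintype V] [DecidableEq V]

variable (ends : E → Sym2 V) (s : V)
/-! ## The type of a vertex -/

/-- The type of `v` in the 2-colouring `ω`: `0` core, `1` world-1-private, `2` world-2-private,
`3` neither. -/
noncomputable def vtype (ω : Config E) (v : V) : Fin 4 :=
  if v ∈ K₁ ends s ω then (if v ∈ K₂ ends s ω then 0 else 1)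
  else (if v ∈ K₂ ends s ω then 2 else 3)

/-- The transferred weight: the weight on the type of a leaf, summed over the two colours of its edge,
as a weight on the type of its neighbour. -/
def transfer (w : Fin 4 → ℚ) : Fin 4 → ℚ
  | 0 => w 1 + w 2
  | 1 => w 1 + w 3
  | 2 => w 2 + w 3
  | 3 => 2 * w 3

omit [Fintype E] [Fintype V] [DecidableEq V] in
/-- The complement of an update is the update of the complement (by the negated bit). -/
lemma compl_update (ω : Config E) (f : E) (b : Bool) :
    compl (Function.update ω f b) = Function.update (compl ω) f (!b) := by
  funext e
  by_cases h : e = f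
  · subst h; simp [compl]
  · simp [compl, Function.update_of_ne h]

/-- The weighted two-world count: `∑_{ω ∈ twoWorld A X B Y} w (type v ω)`. -/
noncomputable def weightedCount (w : Fin 4 → ℚ) (v : V) (A X B Y : Finset V) : ℚ :=
  ∑ ω : Config E, w (vtype ends s ω v) * (if ω ∈ twoWorld ends s A X B Y then 1 else 0)

/-- Flipping the leaf edge is an involution of the configurations. -/
def flipEdge (f : E) : Equiv.Perm (Config E) where
  toFun ω := Function.update ω f (!ω f)
  invFun ω := Function.update ω f (!ω f)
  left_inv ω := by
    funext e
    by_cases h : e = f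
    · subst h; simp
    · simp [Function.update_of_ne h]
  right_inv ω := by
    funext e
    by_cases h : e = f
    · subst h; simp
    · simp [Function.update_of_ne h]

omit [Fintype E] [Fintype V] [DecidableEq V] in
/-- `flipEdge f ω` is `ω` with the bit of `f` negated. -/
lemma flipEdge_apply (f : E) (ω : Config E) : flipEdge f ω = Function.update ω f (!ω f) := rfl

/-! ## Connectivity through a leaf -/

section Leaf

variable {ends} {s}
variable {ℓ u : V} {f : E} (hf : ends f = s(ℓ, u)) (hleaf : ∀ e, ℓ ∈ ends e → e = f) (hℓu : ℓ ≠ u)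

include hf hleaf hℓu

omit [Fintype E] [DecidableEq E] [Fintype V] [DecidableEq V] in
/-- An open edge at the leaf is the leaf edge, and it leads to `u`. -/
lemma openAdj_leaf_eq {ω : Config E} {y : V} (h : OpenAdj ends ω ℓ y) : ω f = true ∧ y = u := by
  obtain ⟨e, he, hends⟩ := h
  have hef : e = f := hleaf e (by rw [hends]; exact Sym2.mem_mk_left ℓ y)
  subst hef
  refine ⟨he, ?_⟩
  rw [hf, Sym2.eq_iff] at hends
  rcases hends with ⟨_, h2⟩ | ⟨_, h2⟩
  · exact h2.symm
  · exact absurd h2.symm hℓu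

omit [Fintype E] [DecidableEq E] [Fintype V] [DecidableEq V] in
/-- An open edge from a non-leaf vertex INTO the leaf is the leaf edge and comes from `u`. -/
lemma openAdj_to_leaf {ω : Config E} {x : V} (h : OpenAdj ends ω x ℓ) :
    ω f = true ∧ x = u := by
  obtain ⟨hω, hxu⟩ := openAdj_leaf_eq hf hleaf hℓu h.symm
  exact ⟨hω, hxu⟩

omit [Fintype E] [DecidableEq E] [Fintype V] [DecidableEq V] in
/-- **Reaching a leaf**: `s ↔ ℓ` iff the leaf edge is open and `s ↔ u` (for a root `s ≠ ℓ`). -/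
theorem conn_leaf_iff {ω : Config E} (hsℓ : s ≠ ℓ) :
    Conn ends ω s ℓ ↔ ω f = true ∧ Conn ends ω s u := by
  constructor
  · intro h
    let S : Set V := {x | (x ≠ ℓ ∧ Conn ends ω s x) ∨ (x = ℓ ∧ ω f = true ∧ Conn ends ω s u)}
    have hS : ∀ x ∈ S, ∀ y, (openGraph ends ω).Adj x y → y ∈ S := by
      intro x hx y hxy
      obtain ⟨hne, hadj⟩ := openGraph_adj.1 hxy
      rcases hx with ⟨hxℓ, hxc⟩ | ⟨hxℓ, hωf, hcu⟩
      · by_cases hyℓ : y = ℓ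
        · subst hyℓ
          obtain ⟨hωf, hxu⟩ := openAdj_to_leaf hf hleaf hℓu hadj
          exact Or.inr ⟨rfl, hωf, hxu ▸ hxc⟩
        · exact Or.inl ⟨hyℓ, conn_trans hxc (conn_of_openAdj hadj)⟩
      · subst hxℓ
        obtain ⟨_, hyu⟩ := openAdj_leaf_eq hf hleaf hℓu hadj
        subst hyu
        exact Or.inl ⟨hℓu.symm, hcu⟩
    have hs : s ∈ S := Or.inl ⟨hsℓ, conn_refl ends ω s⟩
    have := mem_of_conn_of_closed hS hs h
    rcases this with ⟨hℓℓ, _⟩ | ⟨_, hωf, hcu⟩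
    · exact absurd rfl hℓℓ
    · exact ⟨hωf, hcu⟩
  · rintro ⟨hωf, hcu⟩
    refine conn_trans hcu (conn_of_openAdj ⟨f, hωf, ?_⟩)
    rw [hf, Sym2.eq_swap]

omit [Fintype E] [Fintype V] [DecidableEq V] in
/-- **The leaf edge is invisible from elsewhere**: for `v ≠ ℓ`, `s ↔ v` does not depend on the colour of
the leaf edge (one direction). -/
lemma conn_update_leaf_of_conn {ω : Config E} (b : Bool) {v : V} (hv : v ≠ ℓ)
    (h : Conn ends ω s v) (hsℓ : s ≠ ℓ) : Conn ends (Function.update ω f b) s v := by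
  set ω' := Function.update ω f b with hω'
  let S : Set V := {x | (x ≠ ℓ ∧ Conn ends ω' s x) ∨ (x = ℓ ∧ Conn ends ω' s u)}
  have hS : ∀ x ∈ S, ∀ y, (openGraph ends ω).Adj x y → y ∈ S := by
    intro x hx y hxy
    obtain ⟨hne, hadj⟩ := openGraph_adj.1 hxy
    rcases hx with ⟨hxℓ, hxc⟩ | ⟨hxℓ, hcu⟩
    · by_cases hyℓ : y = ℓ
      · subst hyℓ
        obtain ⟨_, hxu⟩ := openAdj_to_leaf hf hleaf hℓu hadj
        exact Or.inr ⟨rfl, hxu ▸ hxc⟩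
      · -- the edge is not the leaf edge, so it is open in `ω'` too
        obtain ⟨e, he, hends⟩ := hadj
        have hef : e ≠ f := by
          intro hef
          subst hef
          rw [hf, Sym2.eq_iff] at hends
          rcases hends with ⟨h1, _⟩ | ⟨h1, _⟩
          · exact hxℓ h1.symm
          · exact hyℓ h1.symm
        have he' : ω' e = true := by rw [hω', Function.update_of_ne hef]; exact he
        exact Or.inl ⟨hyℓ, conn_trans hxc (conn_of_openAdj ⟨e, he', hends⟩)⟩
    · subst hxℓ
      obtain ⟨_, hyu⟩ := openAdj_leaf_eq hf hleaf hℓu hadj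
      subst hyu
      exact Or.inl ⟨hℓu.symm, hcu⟩
  have hs : s ∈ S := Or.inl ⟨hsℓ, conn_refl ends ω' s⟩
  have := mem_of_conn_of_closed hS hs h
  rcases this with ⟨_, hc⟩ | ⟨hvℓ, _⟩
  · exact hc
  · exact absurd hvℓ hv

omit [Fintype E] [Fintype V] [DecidableEq V] in
/-- **The leaf edge is invisible from elsewhere**: for `v ≠ ℓ`, `s ↔ v` does not depend on the colour of
the leaf edge. -/
theorem conn_update_leaf_iff {ω : Config E} (b : Bool) {v : V} (hv : v ≠ ℓ) (hsℓ : s ≠ ℓ) :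
    Conn ends (Function.update ω f b) s v ↔ Conn ends ω s v := by
  constructor
  · intro h
    have := conn_update_leaf_of_conn hf hleaf hℓu (ω := Function.update ω f b) (ω f) hv h hsℓ
    rwa [Function.update_idem, Function.update_eq_self] at this
  · exact fun h => conn_update_leaf_of_conn hf hleaf hℓu b hv h hsℓ

/-! ## The type of a leaf and of its neighbour -/

omit [Fintype E] [DecidableEq E] [Fintype V] [DecidableEq V] in
/-- `ℓ ∈ K₁ ↔ (f red ∧ u ∈ K₁)`. -/
lemma mem_K₁_leaf_iff {ω : Config E} (hsℓ : s ≠ ℓ) :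
    ℓ ∈ K₁ ends s ω ↔ ω f = true ∧ u ∈ K₁ ends s ω :=
  conn_leaf_iff hf hleaf hℓu hsℓ

omit [Fintype E] [DecidableEq E] [Fintype V] [DecidableEq V] in
/-- `ℓ ∈ K₂ ↔ (f blue ∧ u ∈ K₂)`. -/
lemma mem_K₂_leaf_iff {ω : Config E} (hsℓ : s ≠ ℓ) :
    ℓ ∈ K₂ ends s ω ↔ ω f = false ∧ u ∈ K₂ ends s ω := by
  rw [mem_K₂, conn_leaf_iff hf hleaf hℓu hsℓ]
  simp [compl]

omit [Fintype E] [Fintype V] [DecidableEq V] in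
/-- The world-1 membership of a non-leaf vertex ignores the leaf edge. -/
lemma mem_K₁_update_leaf_iff {ω : Config E} (b : Bool) {v : V} (hv : v ≠ ℓ) (hsℓ : s ≠ ℓ) :
    v ∈ K₁ ends s (Function.update ω f b) ↔ v ∈ K₁ ends s ω :=
  conn_update_leaf_iff hf hleaf hℓu b hv hsℓ

omit [Fintype E] [Fintype V] [DecidableEq V] in
/-- The world-2 membership of a non-leaf vertex ignores the leaf edge. -/
lemma mem_K₂_update_leaf_iff {ω : Config E} (b : Bool) {v : V} (hv : v ≠ ℓ) (hsℓ : s ≠ ℓ) :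
    v ∈ K₂ ends s (Function.update ω f b) ↔ v ∈ K₂ ends s ω := by
  rw [mem_K₂, mem_K₂, compl_update]
  exact conn_update_leaf_iff hf hleaf hℓu (!b) hv hsℓ

omit [Fintype E] [Fintype V] [DecidableEq V] in
/-- The type of a non-leaf vertex ignores the leaf edge. -/
lemma vtype_update_leaf {ω : Config E} (b : Bool) {v : V} (hv : v ≠ ℓ) (hsℓ : s ≠ ℓ) :
    vtype ends s (Function.update ω f b) v = vtype ends s ω v := by
  unfold vtype
  simp only [mem_K₁_update_leaf_iff hf hleaf hℓu b hv hsℓ, mem_K₂_update_leaf_iff hf hleaf hℓu b hv hsℓ]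

omit [Fintype E] [DecidableEq E] [Fintype V] [DecidableEq V] in
/-- The type of the leaf with its edge red: `1` if `u ∈ K₁`, `3` otherwise. -/
lemma vtype_leaf_of_red {ω : Config E} (hsℓ : s ≠ ℓ) (hωf : ω f = true) :
    vtype ends s ω ℓ = if u ∈ K₁ ends s ω then 1 else 3 := by
  unfold vtype
  rw [mem_K₁_leaf_iff hf hleaf hℓu hsℓ, mem_K₂_leaf_iff hf hleaf hℓu hsℓ, hωf]
  by_cases hu : u ∈ K₁ ends s ω <;> simp [hu]

omit [Fintype E] [DecidableEq E] [Fintype V] [DecidableEq V] in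
/-- The type of the leaf with its edge blue: `2` if `u ∈ K₂`, `3` otherwise. -/
lemma vtype_leaf_of_blue {ω : Config E} (hsℓ : s ≠ ℓ) (hωf : ω f = false) :
    vtype ends s ω ℓ = if u ∈ K₂ ends s ω then 2 else 3 := by
  unfold vtype
  rw [mem_K₁_leaf_iff hf hleaf hℓu hsℓ, mem_K₂_leaf_iff hf hleaf hℓu hsℓ, hωf]
  by_cases hu : u ∈ K₂ ends s ω <;> simp [hu]

omit [Fintype E] [Fintype V] [DecidableEq V] in
/-- **The pointwise transfer**: the weight of the leaf's type in `ω` plus in `ω` with the leaf edge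
flipped equals the transferred weight of `u`'s type. -/
theorem weight_leaf_add_flip (w : Fin 4 → ℚ) {ω : Config E} (hsℓ : s ≠ ℓ) :
    w (vtype ends s ω ℓ) + w (vtype ends s (Function.update ω f (!ω f)) ℓ) =
      transfer w (vtype ends s ω u) := by
  cases hωf : ω f with
  | false =>
    -- `f` blue in `ω`, red in the flip
    simp only [Bool.not_false]
    rw [vtype_leaf_of_blue hf hleaf hℓu hsℓ hωf,
      vtype_leaf_of_red hf hleaf hℓu hsℓ (Function.update_self f true ω),
      mem_K₁_update_leaf_iff hf hleaf hℓu true hℓu.symm hsℓ]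
    unfold vtype
    by_cases h1 : u ∈ K₁ ends s ω <;> by_cases h2 : u ∈ K₂ ends s ω <;>
      simp only [h1, h2, if_true, if_false, transfer] <;> ring
  | true =>
    -- `f` red in `ω`, blue in the flip
    simp only [Bool.not_true]
    rw [vtype_leaf_of_red hf hleaf hℓu hsℓ hωf,
      vtype_leaf_of_blue hf hleaf hℓu hsℓ (Function.update_self f false ω),
      mem_K₂_update_leaf_iff hf hleaf hℓu false hℓu.symm hsℓ]
    unfold vtype
    by_cases h1 : u ∈ K₁ ends s ω <;> by_cases h2 : u ∈ K₂ ends s ω <;>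
      simp only [h1, h2, if_true, if_false, transfer] <;> ring
/-! ## Summation over the colour of the leaf edge -/

omit [Fintype V] [DecidableEq V] in
/-- **The leaf-gadget transfer**: for every function `g` of the configuration that does not look at
the leaf edge, `2 ∑_ω w (type ℓ ω) · g ω = ∑_ω (T w) (type u ω) · g ω`. -/
theorem leafGadget (w : Fin 4 → ℚ) (g : Config E → ℚ)
    (hg : ∀ ω, g (Function.update ω f (!ω f)) = g ω) (hsℓ : s ≠ ℓ) :
    2 * ∑ ω : Config E, w (vtype ends s ω ℓ) * g ω =
      ∑ ω : Config E, transfer w (vtype ends s ω u) * g ω := by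
  have hsum : ∑ ω : Config E, w (vtype ends s ω ℓ) * g ω =
      ∑ ω : Config E, w (vtype ends s (Function.update ω f (!ω f)) ℓ) * g ω := by
    have := Equiv.sum_comp (flipEdge f) (fun ω => w (vtype ends s ω ℓ) * g ω)
    rw [← this]
    refine Finset.sum_congr rfl fun ω _ => ?_
    rw [flipEdge_apply, hg]
  calc 2 * ∑ ω : Config E, w (vtype ends s ω ℓ) * g ω
      = ∑ ω : Config E, w (vtype ends s ω ℓ) * g ω
          + ∑ ω : Config E, w (vtype ends s (Function.update ω f (!ω f)) ℓ) * g ω := by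
        rw [← hsum]; ring
    _ = ∑ ω : Config E, (w (vtype ends s ω ℓ) + w (vtype ends s (Function.update ω f (!ω f)) ℓ))
          * g ω := by
        rw [← Finset.sum_add_distrib]
        refine Finset.sum_congr rfl fun ω _ => ?_
        ring
    _ = ∑ ω : Config E, transfer w (vtype ends s ω u) * g ω := by
        refine Finset.sum_congr rfl fun ω _ => ?_
        rw [weight_leaf_add_flip hf hleaf hℓu w hsℓ]
/-! ## Application to the two-world events -/

omit [Fintype E] [Fintype V] in
/-- Membership in a two-world event of an instance in which the leaf is unmarked does not depend on
the colour of the leaf edge. -/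
lemma mem_twoWorld_update_leaf_iff {A X B Y : Finset V} (hℓ : ℓ ∉ A ∪ X ∪ B ∪ Y) (hsℓ : s ≠ ℓ)
    (ω : Config E) (b : Bool) :
    Function.update ω f b ∈ twoWorld ends s A X B Y ↔ ω ∈ twoWorld ends s A X B Y := by
  have hA : ℓ ∉ A := fun h => hℓ (by simp [h])
  have hX : ℓ ∉ X := fun h => hℓ (by simp [h])
  have hB : ℓ ∉ B := fun h => hℓ (by simp [h])
  have hY : ℓ ∉ Y := fun h => hℓ (by simp [h])
  simp only [twoWorld, connAll, avoidAll, Set.mem_inter_iff, Set.mem_setOf_eq, mem_bar, compl_update]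
  have h1 : ∀ v ∈ A, (Conn ends (Function.update ω f b) s v ↔ Conn ends ω s v) :=
    fun v hv => conn_update_leaf_iff hf hleaf hℓu b (fun h => hA (h ▸ hv)) hsℓ
  have h2 : ∀ v ∈ X, (Conn ends (Function.update ω f b) s v ↔ Conn ends ω s v) :=
    fun v hv => conn_update_leaf_iff hf hleaf hℓu b (fun h => hX (h ▸ hv)) hsℓ
  have h3 : ∀ v ∈ B, (Conn ends (Function.update (compl ω) f (!b)) s v ↔ Conn ends (compl ω) s v) :=
    fun v hv => conn_update_leaf_iff hf hleaf hℓu (!b) (fun h => hB (h ▸ hv)) hsℓ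
  have h4 : ∀ v ∈ Y, (Conn ends (Function.update (compl ω) f (!b)) s v ↔ Conn ends (compl ω) s v) :=
    fun v hv => conn_update_leaf_iff hf hleaf hℓu (!b) (fun h => hY (h ▸ hv)) hsℓ
  constructor
  · rintro ⟨⟨ha, hx⟩, hb, hy⟩
    exact ⟨⟨fun v hv => (h1 v hv).1 (ha v hv), fun v hv => fun hc => hx v hv ((h2 v hv).2 hc)⟩,
      fun v hv => (h3 v hv).1 (hb v hv), fun v hv => fun hc => hy v hv ((h4 v hv).2 hc)⟩
  · rintro ⟨⟨ha, hx⟩, hb, hy⟩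
    exact ⟨⟨fun v hv => (h1 v hv).2 (ha v hv), fun v hv => fun hc => hx v hv ((h2 v hv).1 hc)⟩,
      fun v hv => (h3 v hv).2 (hb v hv), fun v hv => fun hc => hy v hv ((h4 v hv).1 hc)⟩

omit [Fintype V] in
/-- **The leaf-gadget transfer for the two-world counts**: if the leaf `ℓ` is unmarked,
`2 · (weighted count with `w` at `ℓ`) = weighted count with `T w` at `u``, for L and for R alike. -/
theorem leafGadget_twoWorld (w : Fin 4 → ℚ) {A X B Y : Finset V} (hℓ : ℓ ∉ A ∪ X ∪ B ∪ Y)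
    (hsℓ : s ≠ ℓ) :
    2 * weightedCount ends s w ℓ A X B Y = weightedCount ends s (transfer w) u A X B Y := by
  unfold weightedCount
  refine leafGadget hf hleaf hℓu w _ (fun ω => ?_) hsℓ
  by_cases h : ω ∈ twoWorld ends s A X B Y
  · rw [if_pos h, if_pos ((mem_twoWorld_update_leaf_iff hf hleaf hℓu hℓ hsℓ ω _).2 h)]
  · rw [if_neg h, if_neg (fun h' => h ((mem_twoWorld_update_leaf_iff hf hleaf hℓu hℓ hsℓ ω _).1 h'))]

omit [Fintype V] in
/-- **Weighted (R-1.2) transfers from a leaf to its neighbour**: the weighted inequality with `w` at the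
unmarked leaf `ℓ` holds iff it holds with `T w` at `u`. -/
theorem weighted_le_iff_transfer (w : Fin 4 → ℚ) {A X B Y : Finset V} (hℓ : ℓ ∉ A ∪ X ∪ B ∪ Y)
    (hsℓ : s ≠ ℓ) :
    weightedCount ends s w ℓ A X B Y ≤ weightedCount ends s w ℓ (A ∪ B) (X ∩ Y) ∅ (X ∪ Y) ↔
      weightedCount ends s (transfer w) u A X B Y ≤
        weightedCount ends s (transfer w) u (A ∪ B) (X ∩ Y) ∅ (X ∪ Y) := by
  have hℓ' : ℓ ∉ (A ∪ B) ∪ (X ∩ Y) ∪ ∅ ∪ (X ∪ Y) := by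
    intro h
    apply hℓ
    simp only [Finset.mem_union, Finset.mem_inter, Finset.notMem_empty, or_false] at h ⊢
    tauto
  rw [← leafGadget_twoWorld hf hleaf hℓu w hℓ hsℓ, ← leafGadget_twoWorld hf hleaf hℓu w hℓ' hsℓ]
  constructor
  · intro h; linarith
  · intro h; linarith

end Leaf

/-! ## The weights of record -/
/-- «In the union» `(1,1,1,0)`. -/
def wUnion : Fin 4 → ℚ | 0 => 1 | 1 => 1 | 2 => 1 | 3 => 0
/-- «In exactly one world» `(0,1,1,0)`. -/
def wOneWorld : Fin 4 → ℚ | 0 => 0 | 1 => 1 | 2 => 1 | 3 => 0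
/-- The fixed point `(2,1,1,0)`. -/
def wTwoOne : Fin 4 → ℚ | 0 => 2 | 1 => 1 | 2 => 1 | 3 => 0

/-- The transfer of «in the union» `(1,1,1,0)` is `(2,1,1,0)`. -/
lemma transfer_union : transfer wUnion = wTwoOne := by
  funext i
  match i with
  | 0 => show (1 + 1 : ℚ) = 2; norm_num
  | 1 => show (1 + 0 : ℚ) = 1; norm_num
  | 2 => show (1 + 0 : ℚ) = 1; norm_num
  | 3 => show (2 * 0 : ℚ) = 0; norm_num

/-- The transfer of «in exactly one world» `(0,1,1,0)` is `(2,1,1,0)` as well: a leaf is never in the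
core, so the two statements coincide at a leaf. -/
lemma transfer_oneWorld : transfer wOneWorld = wTwoOne := by
  funext i
  match i with
  | 0 => show (1 + 1 : ℚ) = 2; norm_num
  | 1 => show (1 + 0 : ℚ) = 1; norm_num
  | 2 => show (1 + 0 : ℚ) = 1; norm_num
  | 3 => show (2 * 0 : ℚ) = 0; norm_num

/-- `(2,1,1,0)` is a fixed point of the transfer: `k` leaves at `u` all in the union carry the weight
`(2^k, 1, 1, 0)` at `u` (one leaf at a time). -/
lemma transfer_twoOne : transfer wTwoOne = wTwoOne := by
  funext i
  match i with
  | 0 => show (1 + 1 : ℚ) = 2; norm_num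
  | 1 => show (1 + 0 : ℚ) = 1; norm_num
  | 2 => show (1 + 0 : ℚ) = 1; norm_num
  | 3 => show (2 * 0 : ℚ) = 0; norm_num

end ReimerVdBK

end Summit.Ventures.PercRepro2
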